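import Summits.AnomalousDissipation.AnomalousDissipation.Theorems.TwoAndHalfDTwohalfdThesisStrainGateWitness
import Summits.AnomalousDissipation.AnomalousDissipation.Theorems.TwoAndHalfDTwohalfdThesisStubWindowsToMean
import Summits.AnomalousDissipation.AnomalousDissipation.Theorems.TwoAndHalfDTwohalfdThesisStubShellEnstrophyBound
import Summits.AnomalousDissipation.AnomalousDissipation.Theorems.TwoAndHalfDTwohalfdNegQuietOfSubLog
import Literature.Analysis.FluidPDE.LerayHopfMomentum
import Literature.Analysis.FluidPDE.AlexakisDoeringProofs
import Literature.Analysis.FluidPDE.TorusClassicalLerayHopfProofs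

/-!
# G4 `stub_shellNoGo` — no Stokes-eigenfield force carries a W-witness (line `Sketch`, crux stmt-AnomalousDissipation-0206)

Registered tool stub of the line `Sketch` (duhamel-release) for the crux
`Summit.AnomalousDissipation.AnomalousDissipation.Theses.TwoAndHalfD.TwohalfdThesis`
(stmt-AnomalousDissipation-0206), assembling the strain gate: G1 (`strainGate_of_loss`, in W's format
`releasedFamily_windowStrain_ge`), G2 (`stub_windowsToMean`) and G3 (`stub_shellEnstrophyBound`).

* `releasedFamily_meanStrain_ge` — MEAN-STRAIN FLOOR of a released family with a late loss: for the
  classical planar Navier–Stokes drifts `v_j` (steady smooth mean-zero force, hence global Leray–Hopf with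
  honest running means) and classical releases of one smooth `h` losing the fraction `δ` of `‖h‖²` by age
  `τ₀` from every release time `s ≥ s₀`, the honest `limsup` mean strain obeys
  `⟨‖∇v_j‖₂⟩ ≥ (δ‖h‖² log(1/ν_j)/C − 1)/τ₀` whenever `ν_j ≤ κ₀`.
* `releasedFamily_not_subLogStrain` — THE BRIDGE TO THE NEGATIVE CRUX: along such a family with
  `ν_j → 0`, `h ≠ 0`, `δ > 0`, the mean strain is NOT sub-logarithmic,
  `¬ (⟨‖∇v_j‖₂⟩ / log(1/ν_j) → 0)` — the exact hypothesis under which the sibling crux `TwohalfdNeg`'s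
  landed `stub_quietOfSubLog` (stmt-0211) makes releases quiet.  The two cruxes' open kernels are
  complementary across the threshold "mean planar strain ≍ log(1/ν)".
* `longTimeAvgSup_sqrt_le_sqrt_add_one` — Jensen: an honest mean-enstrophy ceiling `R` gives the
  mean-strain ceiling `√(R+1)` (global Leray–Hopf, mean-zero force).
* `stub_shellNoGo` — the registered statement: W's body with `Δg = −λg` is contradictory
  (`h ≠ 0` by the Green–Kubo floor; a lossy lag exists; floor `≳ log(1/ν_j)` vs the single-shell
  ceiling `√(λE + 1)` of G3).
Supports stmt-AnomalousDissipation-0206. [cite: AlexakisDoering2006PLA, §4; folklore: Crippa–De Lellis 2008, Seis 2022]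
-/

noncomputable section

-- the summit path `AnomalousDissipation/AnomalousDissipation` duplicates a namespace component
set_option linter.dupNamespace false

namespace Summit.AnomalousDissipation.AnomalousDissipation.Theorems.TwohalfdThesis

open MeasureTheory Set Filter Topology
open scoped ENNReal NNReal InnerProductSpace
open Literature.Analysis.FunctionSpaces Literature.Analysis.FluidPDE
open Summit.AnomalousDissipation.AnomalousDissipation.Theorems.TwohalfdNeg.QuietOfSubLog

/-- Local notation: the flat two-torus. -/
local notation "𝕋²" => UnitAddTorus (Fin 2)
/-- Local notation: planar velocity values. -/
local notation "E²" => EuclideanSpace ℝ (Fin 2)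

/-! ## Leray–Hopf bookkeeping for classical planar solutions -/

/-- A classical solution of the steadily forced planar Navier–Stokes system on `[0, ∞)` is a global
Leray–Hopf solution from its own initial slice (`IsClassicalNSSolutionOn.isLerayHopfOn_of_convex`). [folklore] -/
theorem isGlobalLerayHopf_of_isClassicalNSSolutionOn_Ici {ν' : ℝ} {g' : 𝕋² → E²} {v' : ℝ → 𝕋² → E²}
    {p' : ℝ → 𝕋² → ℝ} (hNS : Torus.IsClassicalNSSolutionOn (Ici 0) ν' (fun _ => g') v' p') :
    Torus.IsGlobalLerayHopf ν' (fun _ => g') (v' 0) v' :=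
  fun _T hT => hNS.isLerayHopfOn_of_convex (convex_Ici 0) hT Icc_subset_Ici_self

/-- **Jensen for the mean strain**: along a global Leray–Hopf solution with steady mean-zero force
`g ∈ L²` and `ν > 0` (so that the running means of the enstrophy are bounded and the real `limsup`s
are honest), an enstrophy ceiling `⟨‖∇v‖₂²⟩ ≤ R` gives the strain ceiling
`⟨‖∇v‖₂⟩ ≤ √(R + 1)`. [folklore] -/
theorem longTimeAvgSup_sqrt_le_sqrt_add_one {ν' : ℝ} {g' v₀' : 𝕋² → E²} {v' : ℝ → 𝕋² → E²}
    (hν' : 0 < ν') (hg' : MemLp g' 2 volume) (hgz' : Torus.HasZeroMean g')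
    (hLH : Torus.IsGlobalLerayHopf ν' (fun _ => g') v₀' v') {R : ℝ}
    (hZ : longTimeAvgSup (fun t => (Torus.eGradNormSq (v' t)).toReal) ≤ R) :
    longTimeAvgSup (fun t => Real.sqrt (Torus.eGradNormSq (v' t)).toReal) ≤ Real.sqrt (R + 1) := by
  set Z : ℝ → ℝ := fun t => (Torus.eGradNormSq (v' t)).toReal with hZdef
  have hZ0 : ∀ t, 0 ≤ Z t := fun t => ENNReal.toReal_nonneg
  -- bounded running means of `Z` (Doering–Foias / FMRT (3.4))
  have hbν := hLH.isBoundedUnder_timeMean_dissipation hν' hg' hgz'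
  have hbZ : IsBoundedUnder (· ≤ ·) atTop (timeMean Z) := by
    obtain ⟨b, hb⟩ := hbν
    refine ⟨b / ν', ?_⟩
    rw [eventually_map] at hb ⊢
    filter_upwards [hb] with T hT
    rw [timeMean_const_mul] at hT
    rw [le_div_iff₀ hν']
    linarith [mul_comm ν' (timeMean Z T)]
  have hlim : limsup (timeMean Z) atTop < R + 1 := by
    have : longTimeAvgSup Z ≤ R := hZ
    unfold longTimeAvgSup at this
    linarith
  have hev : ∀ᶠ T in atTop, timeMean Z T < R + 1 := eventually_lt_of_limsup_lt hlim hbZ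
  refine longTimeAvgSup_le_of_eventually_le (fun t => Real.sqrt_nonneg _) ?_
  filter_upwards [hev, eventually_gt_atTop (0 : ℝ)] with T hT hT0
  have hZi : IntegrableOn Z (Ioc 0 T) := by
    rw [integrableOn_Ioc_iff_integrableOn_Ioo]
    exact integrable_toReal_of_lintegral_ne_top (hLH T hT0).aemeasurable_eGradNormSq
      (hLH T hT0).lintegral_eGradNormSq_lt_top.ne
  calc timeMean (fun t => Real.sqrt (Z t)) T ≤ Real.sqrt (timeMean Z T) :=
        timeMean_sqrt_le_sqrt_timeMean hT0 hZ0 hZi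
    _ ≤ Real.sqrt (R + 1) := Real.sqrt_le_sqrt hT.le

/-! ## The mean-strain floor of a released family with a late loss -/

section Family

variable {ν : ℕ → ℝ} {g : 𝕋² → E²} {v : ℕ → ℝ → 𝕋² → E²} {p : ℕ → ℝ → 𝕋² → ℝ}
  {h : 𝕋² → ℝ} {φ : ℕ → ℝ → ℝ → 𝕋² → ℝ} {s₀ τ₀ δ : ℝ}

/-- **Mean-strain floor (G1 ∘ G2 in W's format).**  Classical planar Navier–Stokes drifts `v_j` with a
steady smooth mean-zero force `g` and viscosities `ν_j > 0`, classical releases `φ j s` of one smooth `h`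
at every `s ≥ 0` losing the fraction `δ` of `‖h‖²` by age `τ₀ > 0` from every `s ≥ s₀`: then there are
`κ₀ ∈ (0,1)`, `C > 0` such that for every `j` with `ν_j ≤ κ₀` the honest `limsup` mean strain satisfies
`(δ‖h‖² log(1/ν_j)/C − 1)/τ₀ ≤ ⟨‖∇v_j‖₂⟩`. [folklore] -/
theorem releasedFamily_meanStrain_ge (hν : ∀ j, 0 < ν j) (hg : Torus.IsSmooth g) (hgz : Torus.HasZeroMean g)
    (hNS : ∀ j, Torus.IsClassicalNSSolutionOn (Ici 0) (ν j) (fun _ => g) (v j) (p j))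
    (hh : Torus.IsSmooth h) (hτ₀ : 0 < τ₀)
    (hrel : ∀ j s, 0 ≤ s → Torus.IsClassicalScalarTransportOn (Ici s) (ν j) (v j) (φ j s) ∧ φ j s s = h)
    (hs₀ : 0 ≤ s₀)
    (hloss : ∀ j s, s₀ ≤ s → Torus.scalarL2Sq (φ j s (s + τ₀)) ≤ (1 - δ) * Torus.scalarL2Sq h) :
    ∃ κ₀ C : ℝ, 0 < κ₀ ∧ κ₀ < 1 ∧ 0 < C ∧ ∀ j, ν j ≤ κ₀ →
      (δ * Torus.scalarL2Sq h * Real.log (ν j)⁻¹ / C - 1) / τ₀ ≤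
        longTimeAvgSup (fun t => Real.sqrt (Torus.eGradNormSq (v j t)).toReal) := by
  obtain ⟨κ₀, C, hκ₀, hκ₀1, hC, hwin⟩ := releasedFamily_windowStrain_ge hν hh hτ₀ hrel hs₀ hloss
  refine ⟨κ₀, C, hκ₀, hκ₀1, hC, fun j hj => ?_⟩
  set A : ℝ := δ * Torus.scalarL2Sq h * Real.log (ν j)⁻¹ / C - 1 with hA
  set ψ : ℝ → ℝ := fun t => Real.sqrt (Torus.eGradNormSq (v j t)).toReal with hψ
  have hψ0 : ∀ t, 0 ≤ ψ t := fun t => Real.sqrt_nonneg _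
  rcases lt_or_ge A 0 with hA0 | hA0
  · exact (div_neg_of_neg_of_pos hA0 hτ₀).le.trans (longTimeAvgSup_nonneg hψ0)
  · have hLH := isGlobalLerayHopf_of_isClassicalNSSolutionOn_Ici (hNS j)
    set Φ : ℝ → ℝ≥0∞ := fun t => Torus.eGradNormSq (v j t) ^ (1 / 2 : ℝ) with hΦ
    have hΦψ : (fun t => (Φ t).toReal) = ψ := by
      funext t
      simp only [hΦ, hψ]
      rw [← ENNReal.toReal_rpow, Real.sqrt_eq_rpow]
    have hmeas : AEMeasurable Φ (volume.restrict (Ioi 0)) :=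
      (aemeasurable_eGradNormSq_Ioi hLH).pow_const _
    have hfin : ∀ T, 0 < T → ∫⁻ t in Ioo 0 T, Φ t < ⊤ := fun T hT =>
      lintegral_rpow_half_eGradNormSq_lt_top hLH hT
    have hbdd : IsBoundedUnder (· ≤ ·) atTop (timeMean fun t => (Φ t).toReal) := by
      rw [hΦψ]
      exact isBoundedUnder_timeMean_sqrt_eGradNormSq hLH (hν j) (hg.memLp 2) hgz
    have hG2 := stub_windowsToMean Φ A τ₀ s₀ hmeas hfin hA0 hτ₀ hs₀ (fun s hs => hwin j hj s hs) hbdd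
    rwa [hΦψ] at hG2

/-- **The bridge to the negative crux: released families with a late loss are NOT sub-log-strain.**
Under the hypotheses of `releasedFamily_meanStrain_ge` with `ν_j → 0`, `‖h‖² > 0` and `δ > 0`:
`¬ (⟨‖∇v_j‖₂⟩ / log(1/ν_j) → 0)` — precisely the sub-logarithmic mean-strain hypothesis of the sibling
crux `TwohalfdNeg`'s `stub_quietOfSubLog` (stmt-0211) fails along every such family; indeed
`liminf ⟨‖∇v_j‖₂⟩/log(1/ν_j) ≥ δ‖h‖²/(Cτ₀) > 0`. [folklore] -/
theorem releasedFamily_not_subLogStrain (hν : ∀ j, 0 < ν j) (hν0 : Tendsto ν atTop (𝓝 0))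
    (hg : Torus.IsSmooth g) (hgz : Torus.HasZeroMean g)
    (hNS : ∀ j, Torus.IsClassicalNSSolutionOn (Ici 0) (ν j) (fun _ => g) (v j) (p j))
    (hh : Torus.IsSmooth h) (hh0 : 0 < Torus.scalarL2Sq h) (hτ₀ : 0 < τ₀) (hδ : 0 < δ)
    (hrel : ∀ j s, 0 ≤ s → Torus.IsClassicalScalarTransportOn (Ici s) (ν j) (v j) (φ j s) ∧ φ j s s = h)
    (hs₀ : 0 ≤ s₀)
    (hloss : ∀ j s, s₀ ≤ s → Torus.scalarL2Sq (φ j s (s + τ₀)) ≤ (1 - δ) * Torus.scalarL2Sq h) :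
    ¬ Tendsto (fun j => longTimeAvgSup (fun t => Real.sqrt (Torus.eGradNormSq (v j t)).toReal) /
        Real.log (ν j)⁻¹) atTop (𝓝 0) := by
  obtain ⟨κ₀, C, hκ₀, -, hC, hmean⟩ := releasedFamily_meanStrain_ge hν hg hgz hNS hh hτ₀ hrel hs₀ hloss
  intro hsub
  set Ψ : ℕ → ℝ := fun j => longTimeAvgSup (fun t => Real.sqrt (Torus.eGradNormSq (v j t)).toReal) with hΨ
  set ℓ : ℕ → ℝ := fun j => Real.log (ν j)⁻¹ with hℓ
  set a : ℝ := δ * Torus.scalarL2Sq h / (C * τ₀) with ha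
  have ha0 : 0 < a := by positivity
  have hev1 : ∀ᶠ j in atTop, ν j ≤ κ₀ := hν0.eventually_le_const hκ₀
  have hev2 : ∀ᶠ j in atTop, Ψ j / ℓ j < a / 2 := (tendsto_order.1 hsub).2 _ (by positivity)
  have hev3 : ∀ᶠ j in atTop, 2 / (τ₀ * a) ≤ ℓ j :=
    (tendsto_log_inv_atTop_of_tendsto_zero hν hν0).eventually_ge_atTop _
  obtain ⟨j, hj1, hj2, hj3⟩ := (hev1.and (hev2.and hev3)).exists
  have hℓ0 : 0 < ℓ j := lt_of_lt_of_le (by positivity) hj3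
  have hm := hmean j hj1
  -- `Ψ/ℓ ≥ a − 1/(τ₀ ℓ) ≥ a/2`
  have h1 : a - 1 / (τ₀ * ℓ j) ≤ Ψ j / ℓ j := by
    rw [le_div_iff₀ hℓ0]
    have e : (a - 1 / (τ₀ * ℓ j)) * ℓ j = (δ * Torus.scalarL2Sq h * ℓ j / C - 1) / τ₀ := by
      rw [ha]
      field_simp
    rw [e]
    exact hm
  have h2 : 1 / (τ₀ * ℓ j) ≤ a / 2 := by
    rw [div_le_iff₀ (by positivity)]
    have h3 := hj3
    rw [div_le_iff₀ (by positivity)] at h3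
    nlinarith
  linarith

end Family

/-! ## G4: the single-shell no-go -/

/-- A smooth profile `h ≠ 0` on `T²` has `‖h‖²_{L²} > 0` (continuity and full support of Haar measure).
[folklore] -/
theorem scalarL2Sq_pos_of_ne_zero {h : 𝕋² → ℝ} (hh : Torus.IsSmooth h) (hh0 : h ≠ 0) :
    0 < Torus.scalarL2Sq h := by
  -- adapted from `Theorems/RelaxingFamily/Negative/LinearEnstrophyBudget.lean`
  unfold Torus.scalarL2Sq
  rw [integral_pos_iff_support_of_nonneg (fun x => sq_nonneg (h x)) (hh.memLp 2).integrable_sq]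
  have hsupp : Function.support (fun x => h x ^ 2) = Function.support h := by
    ext x; simp
  rw [hsupp]
  obtain ⟨x, hx⟩ : ∃ x, h x ≠ 0 := Function.ne_iff.1 hh0
  exact (isOpen_ne_fun hh.continuous continuous_const).measure_pos volume ⟨x, hx⟩

/-- **G4 `stub_shellNoGo` (line `Sketch` = duhamel-release, crux `TwoAndHalfD.TwohalfdThesis`; registered
signature): NO STOKES-EIGENFIELD FORCE CARRIES A W-WITNESS.**  The body of the line's open witness
`stub_releasedMixingWitness` — classical planar Navier–Stokes family with steady force `g`, pointwise
energy `≤ E`, classical releases of `h` with a `j`-uniform integrable envelope after the spin-up time and a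
Green–Kubo floor `ε > 0` — is contradictory when `Δg = −λg`, `λ > 0`: the floor forces `h ≠ 0`; an
integrable envelope has a lossy lag `τ₀` (`Λ(τ₀) ≤ 1/2`, loss `δ = 3/4`); the strain gate gives mean strain
`≥ ((3/4)‖h‖² log(1/ν_j)/C − 1)/τ₀ → ∞`, while the single-shell enstrophy identity G3
(Alexakis–Doering 2006 §4) and Jensen cap it by `√(λE + 1)`. [cite: AlexakisDoering2006PLA, §4] -/
theorem stub_shellNoGo :
    ∀ (lam : ℝ) (g : (UnitAddTorus (Fin 2)) → (EuclideanSpace ℝ (Fin 2))) (h : (UnitAddTorus (Fin 2)) → ℝ),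
      0 < lam → (∀ x, Torus.laplacian g x = -(lam • g x)) →
      Torus.IsSmooth g → Torus.IsDivFree g → Torus.HasZeroMean g → Torus.IsSmooth h → Torus.HasZeroMean h →
      ∀ (ν : ℕ → ℝ) (v : ℕ → ℝ → (UnitAddTorus (Fin 2)) → (EuclideanSpace ℝ (Fin 2))) (p : ℕ → ℝ → (UnitAddTorus (Fin 2)) → ℝ) (φ : ℕ → ℝ → ℝ → (UnitAddTorus (Fin 2)) → ℝ)
        (Λ : ℝ → ℝ) (E s₀ M ε : ℝ),
        (∀ j, 0 < ν j) → Tendsto ν atTop (𝓝 0) →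
        (∀ j, Torus.IsClassicalNSSolutionOn (Ici 0) (ν j) (fun _ => g) (v j) (p j)) →
        (∀ j t, 0 ≤ t → ∫ x, ‖v j t x‖ ^ 2 ≤ E) →
        (∀ j s, 0 ≤ s → Torus.IsClassicalScalarTransportOn (Ici s) (ν j) (v j) (φ j s) ∧ φ j s s = h) →
        0 ≤ s₀ → (∀ τ, 0 ≤ Λ τ) → IntegrableOn Λ (Ici 0) → (∫ τ in Ici 0, Λ τ) ≤ M →
        (∀ j s t, s₀ ≤ s → s ≤ t → Torus.scalarL2Sq (φ j s t) ≤ Λ (t - s) ^ 2 * Torus.scalarL2Sq h) →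
        0 < ε →
        (∀ j, ε ≤ liminf (timeMean fun t => ∫ s in (0 : ℝ)..t, ∫ x, h x * φ j s t x) atTop) →
        False := by
  intro lam g h hlam heig hgs hgd hgz hhs _hhz ν v p φ Λ E s₀ M ε hν hν0 hNS hE hrel hs₀ hΛ0 hΛi _hΛM
    henv hε hGK
  -- `h ≠ 0` by the Green–Kubo floor
  have hh0 : 0 < Torus.scalarL2Sq h := by
    by_contra hcon
    have hzero : h = 0 := by
      by_contra hne
      exact hcon (scalarL2Sq_pos_of_ne_zero hhs hne)
    have h1 := hGK 0
    have hconst : (timeMean fun t => ∫ s in (0 : ℝ)..t, ∫ x, h x * φ 0 s t x) = fun _ => 0 := by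
      funext T
      simp [timeMean, hzero]
    rw [hconst, liminf_const] at h1
    exact absurd h1 (not_le.2 hε)
  -- a lossy lag: loss `δ = 3/4` by age `τ₀` from every late release
  obtain ⟨τ₀, hτ₀, hΛτ⟩ := exists_pos_lag_le_half hΛi
  have hloss : ∀ j s, s₀ ≤ s →
      Torus.scalarL2Sq (φ j s (s + τ₀)) ≤ (1 - 3 / 4) * Torus.scalarL2Sq h := by
    intro j s hs
    have h1 := henv j s (s + τ₀) hs (by linarith)
    rw [add_sub_cancel_left] at h1
    have hΛsq : Λ τ₀ ^ 2 ≤ 1 / 4 := by nlinarith [hΛ0 τ₀]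
    calc Torus.scalarL2Sq (φ j s (s + τ₀)) ≤ Λ τ₀ ^ 2 * Torus.scalarL2Sq h := h1
      _ ≤ (1 / 4) * Torus.scalarL2Sq h := mul_le_mul_of_nonneg_right hΛsq hh0.le
      _ = (1 - 3 / 4) * Torus.scalarL2Sq h := by norm_num
  -- the mean-strain floor
  obtain ⟨κ₀, C, hκ₀, hκ₀1, hC, hmean⟩ := releasedFamily_meanStrain_ge hν hgs hgz hNS hhs hτ₀ hrel hs₀ hloss
  -- the mean-strain ceiling (G3 + Jensen)
  have hE0 : 0 ≤ E := le_trans (integral_nonneg fun x => sq_nonneg _) (hE 0 0 le_rfl)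
  set B : ℝ := Real.sqrt (lam * E + 1) with hB
  have hceil : ∀ j, longTimeAvgSup (fun t => Real.sqrt (Torus.eGradNormSq (v j t)).toReal) ≤ B := fun j =>
    longTimeAvgSup_sqrt_le_sqrt_add_one (hν j) (hgs.memLp 2) hgz
      (isGlobalLerayHopf_of_isClassicalNSSolutionOn_Ici (hNS j))
      (stub_shellEnstrophyBound (ν j) lam E g (v j) (p j) (hν j) hlam hgs hgd hgz heig (hNS j) (hE j))
  -- contradiction as `log(1/ν_j) → ∞`
  have hpos : 0 < 3 / 4 * Torus.scalarL2Sq h := by positivity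
  have hev1 : ∀ᶠ j in atTop, ν j ≤ κ₀ := hν0.eventually_le_const hκ₀
  have hev2 : ∀ᶠ j in atTop, (C * (τ₀ * B + 1) + C) / (3 / 4 * Torus.scalarL2Sq h) ≤ Real.log (ν j)⁻¹ :=
    (tendsto_log_inv_atTop_of_tendsto_zero hν hν0).eventually_ge_atTop _
  obtain ⟨j, hj1, hj2⟩ := (hev1.and hev2).exists
  have hm := (hmean j hj1).trans (hceil j)
  rw [div_le_iff₀ hτ₀, sub_le_iff_le_add, div_le_iff₀ hC] at hm
  rw [div_le_iff₀ hpos] at hj2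
  have hB0 : 0 ≤ B := Real.sqrt_nonneg _
  nlinarith

end Summit.AnomalousDissipation.AnomalousDissipation.Theorems.TwohalfdThesis

end
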